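import Summits.ResolutionOfSingularities.ResolutionOfSingularities.Theorems.MarkedTransferCampaignW46WWalkNRTail
import Summits.ResolutionOfSingularities.ResolutionOfSingularities.Theorems.MarkedTransferCampaignW46WWalkNRRoot
import Mathlib.FieldTheory.IsAlgClosed.AlgebraicClosure
import HarnessLib

/-!
# [OURS · L1 W4.6 rung (iii)] o1's regime of record `regimeMohWindowSurfaceInsep` TERMINATES over EVERY PERFECT ground field:
# `MohWindowSurfaceInsepPermissiblyTerminates p K` for `[PerfectField K]` (the NON-RATIONAL W-WALK closes on the door)

Cell `res-hironaka`, LADDER-RESOLUTION rung L (D-0089), slot W4.6 rung (iii) «purely inseparable `z^p = f(x, y)` with `ord f < 2p`»; seat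
res-L1-s46-pv-6 (gen 8). Host route MarkedTransfer (`HypersurfaceOrderReduction`, stmt-ResolutionOfSingularities-16155), `--supports … --as
helper`; kind proof.

WHAT IS PROVED (all OURS): res-L1-s46-pv-5 closed o1's regime of record over ALGEBRAICALLY CLOSED fields
(`…WWalkTerminates.mohWindowSurfaceInsepPermissiblyTerminates_of_isAlgClosed`, p563520) by the W-walk, whose steps and whose endgame (free
chain + approximate door) need every point of the thread to be residually rational. Here:
* `false_of_hitThread_nr` — no hit thread inside `regimeMohWindowSurfaceInsep` over a PERFECT ground field: root anchor over the residue field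
  of the thread's first point (`…WWalkNRRoot`), `Ω` its algebraic closure, the non-rational W-walk along the thread (`…WWalkNRThread`: anchors over
  the residue fields `L_k ↪ Ω`, W-model in `Ω⟦t,y,z⟧`, coefficient subfields and minimal polynomials), pv-5's `eventually_tStep` on the
  `Ω`-model, and the TAIL THEOREM `…WWalkNRTail.tail_false` (W-degree law ⇒ eventual rationality ⇒ descent to pv-5's door; defective
  plateaus removed by shadow walks).
* `regimeMohWindowSurfaceInsep_noHitThread`, `noHitThread_and_permissiblyTerminates_of_perfectField` — NO HIT THREAD in o1's regime over every
  perfect field, hence `MohWindowSurfaceInsepPermissiblyTerminates p K`. The CLOSER BY NAME of o1's `…MohWindowSurface.lean` §3 is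
  res-L1-s46-pv-5's `WWalk.mohWindowSurfaceInsepPermissiblyTerminates_of_perfectField` (p576724, landed 25 minutes earlier through the PORTABLE
  DOOR: the approximate exit base-changed to `Ω⟦t,y,z⟧` by differential operators); THIS file is the INDEPENDENT SECOND PROOF through eventual
  rationality (W-degree law), the plateau shadow walk and descent — the route that pv-5's imperfect-`K` road map (`W-WALK-PLAN.md` §7) needs,
  since the portable door fails over imperfect ground fields.
NOT CLAIMED: imperfect ground fields (cleaning needs `p`-th roots of residue-field elements); anything about the manuscript. H. Hironaka,
ms. 2017-03-23, Th. 16.6 p.84 — scope only, under adjudication [Hironaka2017]. AI-written; AI review is weaker than expert review. No `sorry`;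
axioms standard. References: H. Hauser, Bull. AMS 47 (2010) §§F–G; Stacks Project Tags 0804, 00DV, 030N; H. Matsumura (1986) Thm. 8.3,
28.3, 29.7. [Hauser2010] [StacksProject] [Matsumura1987] [folklore]
-/

noncomputable section

set_option linter.dupNamespace false -- mandated namespace of this single-conjunct summit

open CategoryTheory AlgebraicGeometry TopologicalSpace IsLocalRing MvPowerSeries Finset

namespace Summit.ResolutionOfSingularities.ResolutionOfSingularities.Theorems

namespace CampaignW46

namespace WWalkNR

open Literature.AlgebraicGeometry.Resolution
open Literature.AlgebraicGeometry.Hironaka2017.S02Preliminaries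
open Literature.AlgebraicGeometry.Hironaka2017.Datum
open Scheme.IdealSheafData
open WWalk
open MohWindowShadeFormalNR (order_map_of_injective)

variable {p : ℕ} [hp : Fact p.Prime] {K : Type} [Field K] [CharP K p] [PerfectField K]

/-! ## §1 The walk along a hit thread in `Ω⟦t,y,z⟧` and the tail theorem -/

section Walk

variable {Ω : Type} [Field Ω] [IsAlgClosed Ω] [DecidableEq Ω] [CharP Ω p]

/-- **THE NON-RATIONAL W-WALK CLOSES ON THE DOOR.** [OURS · L1 W4.6 rung (iii-2)] NOT a statement of the manuscript. An infinite
§2.1-permissible sequence inside o1's regime `regimeMohWindowSurfaceInsep` over a perfect ground field, with a hit thread whose root carries a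
`w`-anchor over a perfect field `L ↪ Ω` (`Ω` algebraically closed), does not exist. [cite: Hauser2010, §§F–G] [cite: StacksProject, Tag 0804] -/
theorem false_of_hitThread_wNRAnchor (r : PermissibleRun p K)
    (hr : ∀ k, regimeMohWindowSurfaceInsep (p := p) (K := K) (r.A k) (r.E k)) (t : r.HitThread) (fΩ : MvPowerSeries (Option (Fin 2)) Ω)
    (Λ₀ : Subfield Ω) (hfΩ : LowVanish (p + 1) fΩ)
    (hA0 : ∃ (L : Type) (_ : Field L) (_ : CharP L p) (_ : PerfectField L) (ι : L →+* Ω)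
      (e : AdicCompletion (maximalIdeal ((r.A 0).Z.presheaf.stalk (t.y 0))) ((r.A 0).Z.presheaf.stalk (t.y 0)) ≃+* MvPowerSeries (Option (Fin 2)) L)
      (f₀ : (r.A 0).Z.presheaf.stalk (t.y 0)) (w fL : MvPowerSeries (Option (Fin 2)) L),
      ι.fieldRange = Λ₀ ∧ stalkIdeal (r.E 0).J (t.y 0) = Ideal.span {f₀} ∧ IsUnit w ∧ e (algebraMap _ _ f₀) = w * (X none ^ p + fL) ∧
        MvPowerSeries.map ι fL = fΩ) :
    False := by
  classical
  have hp2 : 2 ≤ p := hp.out.two_le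
  -- the anchor predicate at stage `k` for a model state `(f, r_t, r_y, Λ)`
  let St := MvPowerSeries (Option (Fin 2)) Ω × ℕ × ℕ × Subfield Ω
  let Anch : ℕ → St → Prop := fun k s =>
    (∃ (L : Type) (_ : Field L) (_ : CharP L p) (_ : PerfectField L) (ι : L →+* Ω)
      (e : AdicCompletion (maximalIdeal ((r.A k).Z.presheaf.stalk (t.y k))) ((r.A k).Z.presheaf.stalk (t.y k)) ≃+* MvPowerSeries (Option (Fin 2)) L)
      (f₀ : (r.A k).Z.presheaf.stalk (t.y k)) (w fL : MvPowerSeries (Option (Fin 2)) L),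
      ι.fieldRange = s.2.2.2 ∧ stalkIdeal (r.E k).J (t.y k) = Ideal.span {f₀} ∧ IsUnit w ∧ e (algebraMap _ _ f₀) = w * (X none ^ p + fL) ∧
        MvPowerSeries.map ι fL = s.1) ∧
    LowVanish (p + 1) s.1 ∧ BDiv s.2.1 s.2.2.1 s.1
  -- one step, by `wNRAnchor_succ`
  have G : ∀ (k : ℕ) (P : {s : St // Anch k s}), ∃ (Q : {s : St // Anch (k + 1) s}) (v : Bool) (l γ : Ω),
      ((r.D k : Set (r.A k).Z) = {t.y k} →
        (v = false → Q.1.1 = stepT p l γ P.1.1 ∧ Q.1.2.1 = P.1.1.order.toNat - p ∧ Q.1.2.2.1 = (if l = 0 then P.1.2.2.1 else 0) ∧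
          (l = 0 → 0 < P.1.2.2.1 → γ = 0)) ∧
        (v = true → Q.1.1 = stepT p 0 γ (swapTY P.1.1) ∧ Q.1.2.1 = P.1.1.order.toNat - p ∧ Q.1.2.2.1 = P.1.2.1 ∧
          (0 < P.1.2.1 → γ = 0)) ∧
        P.1.2.2.2 ≤ Q.1.2.2.2 ∧ γ ∈ Q.1.2.2.2 ∧ l ∈ Q.1.2.2.2 ∧ (l ∈ P.1.2.2.2 → Q.1.2.2.2 ≤ P.1.2.2.2) ∧ (v = true → l = 0) ∧
        (∃ π : Polynomial P.1.2.2.2, Irreducible π ∧ π.Separable ∧ (π.map P.1.2.2.2.subtype).IsRoot l)) ∧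
      ((r.D k : Set (r.A k).Z) ≠ {t.y k} → Q.1 = P.1) := by
    intro k P
    obtain ⟨hA, hP2, hB⟩ := P.2
    obtain ⟨f', rt', ry', Λ', v, l, γ, h1, h2, hA', hP2', hB'⟩ := wNRAnchor_succ r hr t k P.1.1 P.1.2.1 P.1.2.2.1 P.1.2.2.2 hA hP2 hB
    refine ⟨⟨(f', rt', ry', Λ'), hA', hP2', hB'⟩, v, l, γ, h1, fun h => ?_⟩
    obtain ⟨e1, e2, e3, e4⟩ := h2 h
    change (f', rt', ry', Λ') = P.1
    rw [e1, e2, e3, e4]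
  choose next nv nl nγ hnext using G
  let seq : ∀ k, {s : St // Anch k s} :=
    fun k => Nat.rec (motive := fun k => {s : St // Anch k s}) ⟨(fΩ, 0, 0, Λ₀), hA0, hfΩ, fun _ _ => ⟨Nat.zero_le _, Nat.zero_le _⟩⟩
      (fun k P => next k P) k
  have hseq : ∀ k, seq (k + 1) = next k (seq k) := fun k => rfl
  -- the hit stages
  set P : ℕ → Prop := fun k => (r.D k : Set (r.A k).Z) = {t.y k} with hP
  have hinf : (setOf P).Infinite :=
    Nat.frequently_atTop_iff_infinite.mp (Filter.frequently_atTop.mpr fun a => t.hit a)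
  have hPnth : ∀ n, P (Nat.nth P n) := Nat.nth_mem_of_infinite hinf
  have hgap : ∀ n m, Nat.nth P n < m → m < Nat.nth P (n + 1) → ¬ P m := by
    intro n m h1 h2 hm
    obtain ⟨i, -, hi⟩ := Nat.exists_lt_card_nth_eq hm
    rw [← hi] at h1 h2
    have := (Nat.nth_lt_nth hinf).mp h1
    have := (Nat.nth_lt_nth hinf).mp h2
    omega
  have hstay : ∀ m, ¬ P m → (seq (m + 1)).1 = (seq m).1 := fun m hm => by
    rw [hseq]; exact (hnext m (seq m)).2 hm
  have hconst : ∀ n d, Nat.nth P n + 1 + d ≤ Nat.nth P (n + 1) →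
      (seq (Nat.nth P n + 1 + d)).1 = (seq (Nat.nth P n + 1)).1 := by
    intro n d
    induction d with
    | zero => intro _; rfl
    | succ d ih =>
      intro hle
      have h1 : (seq (Nat.nth P n + 1 + d + 1)).1 = (seq (Nat.nth P n + 1 + d)).1 :=
        hstay _ (hgap n _ (by omega) (by omega))
      rw [← ih (by omega), ← h1]
      rfl
  -- the model walk, indexed by the hits
  set fM : ℕ → MvPowerSeries (Option (Fin 2)) Ω := fun n => (seq (Nat.nth P n)).1.1 with hfM
  set rtM : ℕ → ℕ := fun n => (seq (Nat.nth P n)).1.2.1 with hrtM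
  set ryM : ℕ → ℕ := fun n => (seq (Nat.nth P n)).1.2.2.1 with hryM
  set ΛM : ℕ → Subfield Ω := fun n => (seq (Nat.nth P n)).1.2.2.2 with hΛM
  set vM : ℕ → Bool := fun n => nv (Nat.nth P n) (seq (Nat.nth P n)) with hvM
  set lM : ℕ → Ω := fun n => nl (Nat.nth P n) (seq (Nat.nth P n)) with hlM
  set γM : ℕ → Ω := fun n => nγ (Nat.nth P n) (seq (Nat.nth P n)) with hγM
  have hnextM : ∀ n, (seq (Nat.nth P (n + 1))).1 = (seq (Nat.nth P n + 1)).1 := by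
    intro n
    have hlt : Nat.nth P n < Nat.nth P (n + 1) := (Nat.nth_lt_nth hinf).mpr (Nat.lt_succ_self n)
    obtain ⟨d, hd⟩ : ∃ d, Nat.nth P (n + 1) = Nat.nth P n + 1 + d := ⟨Nat.nth P (n + 1) - (Nat.nth P n + 1), by omega⟩
    rw [hd]
    exact hconst n d (by omega)
  have hhitrel : ∀ n,
      (vM n = false → fM (n + 1) = stepT p (lM n) (γM n) (fM n) ∧ rtM (n + 1) = (fM n).order.toNat - p ∧
        ryM (n + 1) = (if lM n = 0 then ryM n else 0) ∧ (lM n = 0 → 0 < ryM n → γM n = 0)) ∧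
      (vM n = true → fM (n + 1) = stepT p 0 (γM n) (swapTY (fM n)) ∧ rtM (n + 1) = (fM n).order.toNat - p ∧
        ryM (n + 1) = rtM n ∧ (0 < rtM n → γM n = 0)) ∧
      ΛM n ≤ ΛM (n + 1) ∧ γM n ∈ ΛM (n + 1) ∧ lM n ∈ ΛM (n + 1) ∧ (lM n ∈ ΛM n → ΛM (n + 1) ≤ ΛM n) ∧ (vM n = true → lM n = 0) ∧
      (∃ π : Polynomial (ΛM n), Irreducible π ∧ π.Separable ∧ (π.map (ΛM n).subtype).IsRoot (lM n)) := by
    intro n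
    have h := (hnext (Nat.nth P n) (seq (Nat.nth P n))).1 (hPnth n)
    rw [← hseq] at h
    simp only [hfM, hrtM, hryM, hΛM, hvM, hlM, hγM, hnextM n]
    exact h
  -- per-hit facts from the regime at the hit stage
  have hfacts : ∀ n, ∃ d : ℕ, (fM n).order = d ∧ p + 1 ≤ d ∧ d ≤ 2 * p - 1 ∧ LowVanish d (fM n) ∧
      (∃ a b c, a + b + c = d ∧ coeff (mk3 a b c) (fM n) ≠ 0) ∧ (d - rtM n - ryM n < p → NDz d (fM n)) := by
    intro n
    obtain ⟨⟨L, _iF, _iC, _iP, ι, e, f₀, w, fL, -, hJ, hw, hE, hfL⟩, hP2, hB⟩ := (seq (Nat.nth P n)).2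
    have hP2L : LowVanish (p + 1) fL := (lowVanish_map_iff ι (p + 1) fL).mp (by rw [hfL]; exact hP2)
    have hBL : BDiv (rtM n) (ryM n) fL := (bdiv_map_iff ι (rtM n) (ryM n) fL).mp (by rw [hfL]; exact hB)
    obtain ⟨d, hd, hpd, hd2, hlow, ⟨a, b, c, habc, hne⟩, hnd⟩ := residual_facts (hr _) (t.mem _) e hJ hw hE hP2L hBL
    have hfM' : fM n = MvPowerSeries.map ι fL := hfL.symm
    refine ⟨d, by rw [hfM', order_map_of_injective ι ι.injective, hd], hpd, hd2, by rw [hfM']; exact (lowVanish_map_iff ι d fL).mpr hlow,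
      ⟨a, b, c, habc, by rw [hfM', MvPowerSeries.coeff_map, map_ne_zero_iff ι ι.injective]; exact hne⟩, fun h => ?_⟩
    rw [hfM']
    exact (ndz_map_iff ι d fL).mpr (hnd h)
  choose dM hdM using hfacts
  have hdto : ∀ n, (fM n).order.toNat = dM n := fun n => by rw [(hdM n).1]; rfl
  have hiso : ∀ n, rtM n < p ∧ ryM n < p := by
    intro n
    obtain ⟨⟨L, _iF, _iC, _iP, ι, e, f₀, w, fL, -, hJ, -, hE, hfL⟩, -, hB⟩ := (seq (Nat.nth P n)).2
    have hBL : BDiv (rtM n) (ryM n) fL := (bdiv_map_iff ι (rtM n) (ryM n) fL).mp (by rw [hfL]; exact hB)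
    exact bdiv_lt_of_wAnchor (hr _) e hJ hE hBL
  -- the combinatorial termination: a `T`-tail
  obtain ⟨N, hN⟩ := eventually_tStep hp2 fM rtM ryM dM vM lM γM (fun n => (seq (Nat.nth P n)).2.2.2) (fun n => (hdM n).2.2.2.1)
    (fun n => (hdM n).2.2.2.2.1) (fun n => ⟨(hdM n).2.1, (hdM n).2.2.1⟩) hiso
    (fun n hv => by have h := (hhitrel n).1 hv; rw [hdto] at h; exact h)
    (fun n hv => by have h := (hhitrel n).2.1 hv; rw [hdto] at h; exact h)
    (fun n => (hdM n).2.2.2.2.2)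
  -- the tail theorem
  refine tail_false (Ω := Ω) r hr t (p - 2) (fun n => Nat.nth P (N + n)) (fun n => fM (N + n)) (fun n => rtM (N + n)) (fun n => ryM (N + n))
    (fun n => ΛM (N + n)) (fun n => lM (N + n)) (fun n => γM (N + n)) (fun n => ?_) (fun n => (seq (Nat.nth P (N + n))).2.2)
    (fun n => ?_) (fun n => ?_) (fun n => (hhitrel (N + n)).2.2.2.2.2.2.2) (fun n => ?_)
  · obtain ⟨⟨L, _iF, _iC, -, ι, e, f₀, w, fL, hΛ, hJ, hw, hE, hfL⟩, -, -⟩ := (seq (Nat.nth P (N + n))).2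
    exact ⟨L, _iF, _iC, ι, e, f₀, w, fL, hΛ, hJ, hw, hE, hfL⟩
  · have hv : vM (N + n) = false := hN _ (by omega)
    have h := (hhitrel (N + n)).1 hv
    rw [show N + (n + 1) = N + n + 1 by omega]
    exact h
  · have h := (hhitrel (N + n)).2.2
    rw [show N + (n + 1) = N + n + 1 by omega]
    exact ⟨h.1, h.2.1, h.2.2.1, h.2.2.2.1⟩
  · rw [hdto]
    have := (hdM (N + n)).2.1
    omega

end Walk

/-! ## §2 The root and the closers -/

/-- **No hit thread inside o1's regime of record over a perfect ground field.** [OURS · L1 W4.6 rung (iii)] NOT a statement of the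
manuscript. [cite: Matsumura1987, Thm. 29.7] [cite: StacksProject, Tag 0804] -/
theorem false_of_hitThread_nr (r : PermissibleRun p K) (hr : ∀ k, regimeMohWindowSurfaceInsep (p := p) (K := K) (r.A k) (r.E k))
    (t : r.HitThread) : False := by
  classical
  obtain ⟨L, _iF, _iC, _iP, e, f₀, w, f, hJ, hw, hE, hfP2⟩ := exists_wAnchor_start_nr (hr 0) (t.mem 0)
  set Ω := AlgebraicClosure L
  set ι : L →+* Ω := algebraMap L (AlgebraicClosure L) with hι
  haveI : CharP Ω p := charP_of_injective_ringHom ι.injective p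
  exact false_of_hitThread_wNRAnchor (Ω := Ω) r hr t (MvPowerSeries.map ι f) ι.fieldRange ((lowVanish_map_iff ι (p + 1) f).mpr hfP2)
    ⟨L, _iF, _iC, _iP, ι, e, f₀, w, f, rfl, hJ, hw, hE, rfl⟩

/-- **No hit thread in o1's regime of record**, every PERFECT ground field of characteristic `p`. [OURS · L1 W4.6 rung (iii)] NOT a statement of
the manuscript. [cite: StacksProject, Tag 0804] -/
theorem regimeMohWindowSurfaceInsep_noHitThread : NoHitThread (regimeMohWindowSurfaceInsep (p := p) (K := K)) :=
  fun r hr t => false_of_hitThread_nr r hr t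

variable (p) (K)

/-- **RUNG (iii) over every PERFECT field by the non-rational W-walk — the independent second proof.** No hit thread in o1's regime of record
AND (hence, through res-L1-s46-pv-1's `permissiblyTerminates_of_noHitThread`) no infinite §2.1-permissible sequence inside it:
`MohWindowSurfaceInsepPermissiblyTerminates p K`. The statement of record under this name is res-L1-s46-pv-5's
`WWalk.mohWindowSurfaceInsepPermissiblyTerminates_of_perfectField` (portable door); this conjunction records the second route (W-degree law,
plateau shadow walk, descent). [OURS · L1 W4.6 rung (iii)] NOT a statement of the manuscript. [cite: Hauser2010, §F (setting f = x^p + y^r g)]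
[cite: StacksProject, Tag 0804] -/
theorem noHitThread_and_permissiblyTerminates_of_perfectField :
    NoHitThread (regimeMohWindowSurfaceInsep (p := p) (K := K)) ∧ MohWindowSurfaceInsepPermissiblyTerminates p K :=
  ⟨regimeMohWindowSurfaceInsep_noHitThread,
    permissiblyTerminates_of_noHitThread (fun A E h => ((regimeMohWindowSurfaceInsep_iff A E).mp h).1.1) regimeMohWindowSurfaceInsep_noHitThread⟩

end WWalkNR

end CampaignW46

end Summit.ResolutionOfSingularities.ResolutionOfSingularities.Theorems

end
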